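import Summits.Ventures.PercRepro.SixFourResidueThreeList
import Summits.Ventures.PercRepro.SixFourResidueThreeIdentity
import Summits.Ventures.PercRepro.SixFourResidueThreeXbar2B
import Summits.Ventures.PercRepro.SixFourResidueSteps
import Summits.Ventures.PercRepro.SixFourResidueSmallG
import Summits.Ventures.PercRepro.SixFourPLTypesP
import Summits.Ventures.PercRepro.SixFourPLBonus

/-!
# PercRepro — C-025 at `(6,4)`: the `t = 3` plane-line piece for `7 ≤ g ≤ 10` (p2, gen 8 — §21.18.9.4–5, Theorem 21″'s
(γ) branch on the exact lists)

Theorem 22.12 at `t = 3`: for a normalisation `D` of a plane-line set with plane traces `≤ g − 3` and `7 ≤ g ≤ 10`,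
`10·J3low(π(G)) ≤ 10·J₃(G)` (`J3_10_profile_le`) — the identity `J_three_identity` with the four steps: (1) the
cost bound (`cost3_profile_le_K`: `cost₃_g ≥ 0` on the third-kind entries for `q ≤ g − 1`, the list domination
`sum_tyP_le_K`), (2) the bonus bound (`bonus3_profile_le_K`, `bonus₃ ≥ 0` for `m ≤ 10`), (3) `lpp_profile_le_K`,
(4) Lemma X̄₂ (`X2cnt_le_Xbar2_profile` — E21-1 (b), proved in `SixFourResidueThreeXbar2A/B`).  With `profile_mem_LISTK` and the
finite checks `J3_10_pos_of_mem`: `J_three_nonneg_of_planeLine_le_ten`.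
-/

namespace PercRepro.SixFour

open Finset ThmH

variable {α : Type*} [DecidableEq α] {M : Matroid α} [M.Finite] {G : Finset α}

namespace PL

/-- `cost3_10` depends only on the type (small list planes). -/
theorem cost3_10_ty (g : ℕ) (Q : Pl) (hQ : Small Q) : cost3_10 g (ty Q) = cost3_10 g Q := by
  unfold cost3_10
  rw [D3_ty Q hQ, r34_ty Q hQ, ty_q]

/-- **`cost₃_g ≥ 0` on the third-kind entry `i`** when `q = i + 3 ≤ g − 1` (`D₃ ≥ r₃₄`, `18 + 15(g − q) ≥ 24`). -/
theorem cost3_10_xlEntry_nonneg (π : CProf) (g : ℕ) (i : ℕ) (hi : i ≤ 5) (hq : i + 4 ≤ g) :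
    0 ≤ cost3_10 g (xlEntry π i) := by
  have hg' : ((i : ℤ) + 4) ≤ g := by exact_mod_cast hq
  obtain ⟨d2, d3, d4, d5, d6, d7, d8⟩ := delta_small
  obtain ⟨c2, c3, c4, c5, c6, c7, c8⟩ := ch_four_small
  unfold cost3_10 D3 r34 xlEntry
  interval_cases i <;>
    simp only [Nat.reduceAdd, Nat.reduceLT, ↓reduceIte, List.map_cons, List.map_nil, List.sum_cons, List.sum_nil,
      d2, d3, d4, d5, d6, d7, d8, c2, c3, c4, c5, c6, c7, c8] <;>
    push_cast at hg' ⊢ <;> nlinarith [hg']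

/-- `bonus3_10 m = 10·bonus₃(m)`. -/
theorem bonus3_10_eq (m : ℕ) : (bonus3_10 m : ℚ) = 10 * bonus3 m := by
  unfold bonus3_10 bonus3
  rw [PLeps_eq, PLdelta_eq, PLch_eq_choose]
  push_cast
  ring

end PL

/-- `bonus₃(m) ≥ 0` for `m ≤ 11`. -/
theorem bonus3_nonneg {m : ℕ} (hm : m ≤ 10) : 0 ≤ bonus3 m := by
  unfold bonus3 eps delta S3
  interval_cases m <;> norm_num [Nat.choose]

/-- `cost3_10 (tyP P) = 10·cost₃_g(P)` for a rank-`3` trace with `≤ 7` points. -/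
theorem cost3_tyP (hs : Simple M) (hG : G ⊆ gr M) {P : Finset α} (h7 : (P ∩ G).card ≤ 7)
    (hr : M.eRk ((P ∩ G : Finset α) : Set α) = 3) :
    (PL.cost3_10 G.card (tyP M G P) : ℚ) = 10 * cost3 M G P := by
  have hD := D3_add_profile hs hG h7 hr
  have hR := r34_add_profile hs hG h7 hr
  have hi7 : inc M (P ∩ G) 7 = 0 := inc_eq_zero_of_card_le hr (by omega)
  have hD' : (D3 M G P : ℚ) = (delta (P ∩ G).card : ℚ) -
      (inc M (P ∩ G) 4 + 6 * inc M (P ∩ G) 5 + 22 * inc M (P ∩ G) 6 : ℚ) := by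
    have := congrArg (fun n : ℕ => (n : ℚ)) hD
    push_cast at this
    linarith
  have hR' : (r34 M G P : ℚ) = ((P ∩ G).card.choose 4 : ℚ) -
      (inc M (P ∩ G) 4 + 5 * inc M (P ∩ G) 5 + 15 * inc M (P ∩ G) 6 : ℚ) := by
    have := congrArg (fun n : ℕ => (n : ℚ)) hR
    push_cast at this
    linarith
  unfold PL.cost3_10 PL.D3 PL.r34 tyP cost3
  simp only [List.range_succ, List.range_zero, List.map_cons, List.map_nil, List.sum_cons, List.sum_nil,
    List.nil_append, List.cons_append, PLdelta_eq, PLch_eq_choose, hi7]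
  obtain ⟨d0, d1, d2, d3, d4, d5, d6⟩ := delta_values
  have hc : Nat.choose 3 4 = 0 ∧ Nat.choose 4 4 = 1 ∧ Nat.choose 5 4 = 5 ∧ Nat.choose 6 4 = 15 := by decide
  obtain ⟨c3, c4, c5, c6⟩ := hc
  simp only [d3, d4, d5, d6, c3, c4, c5, c6]
  push_cast
  rw [hD', hR']
  ring

namespace PLData

variable {D : PLData M G}

/-- `cost₃ = 0` on the planes with a trace of rank `≤ 2`: `Σ_planes cost₃ ≤ Σ_{planesR3} cost₃`. -/
theorem sum_cost3_le : ∑ P ∈ planes M, cost3 M G P ≤ ∑ P ∈ planesR3 M G, cost3 M G P := by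
  unfold planesR3
  rw [← Finset.sum_filter_add_sum_filter_not (planes M) (fun P : Finset α => M.eRk ((P ∩ G : Finset α) : Set α) = 3)]
  have h0 : ∑ P ∈ (planes M).filter (fun P : Finset α => ¬ M.eRk ((P ∩ G : Finset α) : Set α) = 3), cost3 M G P = 0 := by
    apply Finset.sum_eq_zero
    intro P hP
    rw [Finset.mem_filter] at hP
    obtain ⟨hD, hR⟩ := D3_r34_eq_zero_of_ne hP.1 hP.2
    unfold cost3
    rw [hD, hR]
    simp
  rw [h0, add_zero]

/-- **Step (1) at `t = 3`**: `10·Σ_{P ∈ planes M} cost₃_g(P) ≤ cost3_10sum(π)` for plane traces `≤ g − 3`, `7 ≤ g ≤ 10`. -/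
theorem cost3_profile_le_K (hs : Simple M) (hG : G ⊆ gr M) (hpl : ∀ P ∈ planes M, (P ∩ G).card + 3 ≤ G.card)
    (hg : 7 ≤ G.card) (hg10 : G.card ≤ 10) : 10 * ∑ P ∈ planes M, cost3 M G P ≤ (PL.cost3_10sum D.profile : ℚ) := by
  obtain ⟨h2, -, hne, hp7, hpl7, hsz⟩ := steps_facts (D := D) hs hG hpl hg hg10
  have h1 : 10 * ∑ P ∈ planes M, cost3 M G P ≤ 10 * ∑ P ∈ planesR3 M G, cost3 M G P :=
    mul_le_mul_of_nonneg_left sum_cost3_le (by norm_num)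
  have h2' : 10 * ∑ P ∈ planesR3 M G, cost3 M G P = ∑ P ∈ planesR3 M G, (PL.cost3_10 G.card (tyP M G P) : ℚ) := by
    rw [Finset.mul_sum]
    refine Finset.sum_congr rfl (fun P hP => ?_)
    obtain ⟨hP, hr3⟩ := mem_planesR3.1 hP
    rw [cost3_tyP hs hG (hpl7 P hP) hr3]
  have h3 : ∑ P ∈ planesR3 M G, (PL.cost3_10 G.card (tyP M G P) : ℚ) ≤
      ((PL.planes D.profile).map fun Q => (Q.mult : ℚ) * (PL.cost3_10 G.card (PL.ty Q) : ℚ)).sum :=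
    sum_tyP_le_K hs hG h2 hp7 (fun Q => (PL.cost3_10 G.card Q : ℚ)) (fun i hi hnu => by
      rw [PL.cost3_10_ty _ _ (PL.Small_xlEntry _ i (by omega))]
      have := six_add_le_of_nu_pos (D := D) hpl hi hnu
      exact_mod_cast PL.cost3_10_xlEntry_nonneg D.profile G.card i (by omega) (by omega))
  have h4 : ((PL.planes D.profile).map fun Q => (Q.mult : ℚ) * (PL.cost3_10 G.card (PL.ty Q) : ℚ)).sum =
      (PL.cost3_10sum D.profile : ℚ) := by
    unfold PL.cost3_10sum
    rw [g_profile_eq]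
    push_cast
    rw [List.map_map]
    refine congrArg List.sum (List.map_congr_left (fun Q hQ => ?_))
    simp only [Function.comp_apply, Int.cast_mul, Int.cast_natCast]
    rw [PL.cost3_10_ty _ _ (PL.Small_of_mem_planes D.profile
      (by rw [e_profile_eq hs hG h2]; show D.L.card + (D.ellF ∩ D.ρ).card ≤ 7; omega)
      (fun s hs' => by have := hsz s hs'; omega) hQ)]
  linarith [h1, h2', h3, h4]

/-- The profile's `bonus₃` sum in closed form (mirror of `bonus5sum_eq`). -/
theorem bonus3_10sum_eq (hs : Simple M) (hG : G ⊆ gr M) (h2 : 2 ≤ D.L.card)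
    (hn6 : D.L.card + (D.ellF ∩ D.ρ).card ≤ 6) (h3 : 3 ≤ D.L.card) :
    PL.bonus3_10sum D.profile = PL.bonus3_10 (PL.lprime D.profile) +
      ∑ m ∈ Finset.range 8, (inc M D.ρ m : ℤ) * PL.bonus3_10 m := by
  have hl : PL.lprime D.profile = D.L.card + (D.ellF ∩ D.ρ).card := by
    unfold PL.lprime
    rw [e_profile_eq hs hG h2]
    rfl
  have hinc : ∀ m, 2 ≤ m → m ≤ 7 → PL.incOf D.profile m = inc M D.ρ m := by
    intro m hm2 hm7
    unfold PL.incOf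
    rw [if_pos hm2, inc_profile (m - 2) (by omega), show m - 2 + 2 = m by omega]
  have hb0 : PL.bonus3_10 0 = 0 := by decide
  have hb1 : PL.bonus3_10 1 = 0 := by decide
  have hb2 : PL.bonus3_10 2 = 0 := by decide
  obtain ⟨l, hl'⟩ : ∃ l, PL.lprime D.profile = l := ⟨_, rfl⟩
  have hl3 : 3 ≤ l := by omega
  have hl6 : l ≤ 6 := by omega
  unfold PL.bonus3_10sum PL.b
  rw [hl']
  simp only [List.range_succ, List.range_zero, List.map_cons, List.map_nil, List.sum_cons, List.sum_nil,
    Nat.zero_add, List.nil_append, List.cons_append, Finset.sum_range_succ, Finset.sum_range_zero]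
  rw [hinc 2 (by norm_num) (by norm_num), hinc 3 (by norm_num) (by norm_num), hinc 4 (by norm_num) (by norm_num),
    hinc 5 (by norm_num) (by norm_num), hinc 6 (by norm_num) (by norm_num), hinc 7 (by norm_num) (by norm_num)]
  interval_cases l <;> simp [hb0, hb1, hb2] <;> ring

/-- **Step (2) at `t = 3`**: `bonus3_10sum(π) ≤ 10·Σ_{L ∈ lines M} bonus₃(|L ∩ G|)` (mirror of `bonus5sum_profile_le`;
`bonus₃ ≥ 0` on the traces, which have `≤ g ≤ 10` points). -/
theorem bonus3_profile_le_K (hs : Simple M) (hG : G ⊆ gr M) (hpl : ∀ P ∈ planes M, (P ∩ G).card + 3 ≤ G.card)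
    (hg : 7 ≤ G.card) (hg10 : G.card ≤ 10) :
    (PL.bonus3_10sum D.profile : ℚ) ≤ 10 * ∑ L ∈ lines M, bonus3 (L ∩ G).card := by
  classical
  obtain ⟨h2, h3, hn6, hp7, -, -⟩ := steps_facts (D := D) hs hG hpl hg hg10
  have hbn : ∀ L : Finset α, 0 ≤ bonus3 (L ∩ G).card := fun L =>
    bonus3_nonneg ((Finset.card_le_card Finset.inter_subset_right).trans (by omega))
  have hℓ := (D.ellF_mem_lines hs hG h2).1
  rw [bonus3_10sum_eq hs hG h2 hn6 h3]
  push_cast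
  rw [PL.bonus3_10_eq]
  have hsplit : ∑ L ∈ lines M, bonus3 (L ∩ G).card =
      bonus3 (D.ellF ∩ G).card + ∑ L ∈ (lines M).erase D.ellF, bonus3 (L ∩ G).card :=
    (Finset.add_sum_erase _ _ hℓ).symm
  rw [hsplit, card_ellF_inter_G_eq hs hG h2]
  have hsub : ∑ L ∈ ((lines M).erase D.ellF).filter (fun L => 2 ≤ (L ∩ D.ρ).card), bonus3 (L ∩ G).card ≤
      ∑ L ∈ (lines M).erase D.ellF, bonus3 (L ∩ G).card :=
    Finset.sum_le_sum_of_subset_of_nonneg (Finset.filter_subset _ _) (fun L _ _ => hbn L)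
  have hfilt : ((lines M).erase D.ellF).filter (fun L => 2 ≤ (L ∩ D.ρ).card) =
      (lines M).filter (fun L => 2 ≤ (L ∩ D.ρ).card) := by
    ext L
    rw [Finset.mem_filter, Finset.mem_filter, Finset.mem_erase]
    constructor
    · rintro ⟨⟨-, hL⟩, h⟩
      exact ⟨hL, h⟩
    · rintro ⟨hL, h⟩
      exact ⟨⟨ne_ellF_of_two_le hs hG h2 h, hL⟩, h⟩
  rw [hfilt] at hsub
  have hval : ∑ L ∈ (lines M).filter (fun L => 2 ≤ (L ∩ D.ρ).card), bonus3 (L ∩ G).card =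
      ∑ L ∈ (lines M).filter (fun L => 2 ≤ (L ∩ D.ρ).card), bonus3 (L ∩ D.ρ).card := by
    refine Finset.sum_congr rfl (fun L hL => ?_)
    rw [Finset.mem_filter] at hL
    rw [inter_G_eq_inter_ρ_of_two_le hs hL.1 hL.2]
  have hb0 : bonus3 0 = 0 := by unfold bonus3 eps delta S3; norm_num
  have hb1 : bonus3 1 = 0 := by unfold bonus3 eps delta S3; norm_num
  have hfull : ∑ L ∈ (lines M).filter (fun L => 2 ≤ (L ∩ D.ρ).card), bonus3 (L ∩ D.ρ).card =
      ∑ L ∈ lines M, bonus3 (L ∩ D.ρ).card := by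
    apply Finset.sum_subset (Finset.filter_subset _ _)
    intro L hL hnot
    rw [Finset.mem_filter] at hnot
    push Not at hnot
    have hc : (L ∩ D.ρ).card < 2 := hnot hL
    rcases (show (L ∩ D.ρ).card = 0 ∨ (L ∩ D.ρ).card = 1 by omega) with h | h <;> rw [h]
    · exact hb0
    · exact hb1
  have hall : ∑ L ∈ lines M, bonus3 (L ∩ D.ρ).card =
      ∑ m ∈ Finset.range (D.ρ.card + 1), (inc M D.ρ m : ℚ) * bonus3 m := by
    rw [← Finset.sum_fiberwise_of_maps_to' (g := fun L : Finset α => (L ∩ D.ρ).card)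
      (t := Finset.range (D.ρ.card + 1)) (fun L _ => by
        rw [Finset.mem_range]; exact Nat.lt_succ_of_le (Finset.card_le_card Finset.inter_subset_right))]
    refine Finset.sum_congr rfl (fun m _ => ?_)
    rw [Finset.sum_const, nsmul_eq_mul]
    rfl
  have hext : ∑ m ∈ Finset.range (D.ρ.card + 1), (inc M D.ρ m : ℚ) * bonus3 m =
      ∑ m ∈ Finset.range 8, (inc M D.ρ m : ℚ) * bonus3 m := by
    refine Finset.sum_subset (fun m hm => by rw [Finset.mem_range] at hm ⊢; omega) (fun m hm hnm => ?_)
    rw [Finset.mem_range] at hm hnm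
    rw [inc_eq_zero_of_card_le (eRk_ρ (D := D)) (by omega)]
    simp
  have hkey : ∑ m ∈ Finset.range 8, (inc M D.ρ m : ℚ) * bonus3 m ≤
      ∑ L ∈ (lines M).erase D.ellF, bonus3 (L ∩ G).card := by
    rw [← hext, ← hall, ← hfull, ← hval]
    exact hsub
  have hb10 : ∑ m ∈ Finset.range 8, (inc M D.ρ m : ℚ) * (PL.bonus3_10 m : ℚ) =
      10 * ∑ m ∈ Finset.range 8, (inc M D.ρ m : ℚ) * bonus3 m := by
    rw [Finset.mul_sum]
    refine Finset.sum_congr rfl (fun m _ => ?_)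
    rw [PL.bonus3_10_eq]
    ring
  rw [hb10]
  linarith

/-- **Step (4) at `t = 3` — Lemma X̄₂ (E21-1 (b))**: `X₂ ≤ X̄₂(π)` for a normalisation of a plane-line set with plane
traces `≤ g − 3`.  Proof sketch (§21.18.9.5): choose for every `Z` counted by `X₂` a plane `P′ ⊇ G ∖ Z` with a rank-`3`
trace; `P′ = ρ` gives `Z ∈ {L, L ∪ {z}}` (`1 + e`); `P′ = Π_j` gives `Z ⊇ ρ ∖ λ_j` (`p − s_j ≥ 3` points on a line `μ` of
`ρ` with `|μ| ∈ {p − s_j, p − s_j + 1}`, `|μ ∩ λ_j| ≤ 1`) — `≤ 2` sets, only if `inc_{p−s_j} + inc_{p−s_j+1} > 0`;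
`P′ = {x} ∪ λ` gives `Z ⊇ (ρ ∖ λ) ∪ (L ∖ {x})` collinear, hence `Z ⊆ ℓ′` — impossible in the skew case, and in the
meeting case (`inc_{p−1} ≥ 1`) `Z ∈ {ℓ′ ∖ {x}, ℓ′}`, `≤ 2` per `x`.  PROVED in `SixFourResidueThreeXbar2A/B.lean`. -/
theorem X2cnt_le_Xbar2_profile (hs : Simple M) (hG : G ⊆ gr M) (hr : M.eRk (G : Set α) = 4)
    (hpl : ∀ P ∈ planes M, (P ∩ G).card + 3 ≤ G.card) (hg : 7 ≤ G.card) (hg10 : G.card ≤ 10) :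
    X2cnt M G ≤ PL.Xbar2 D.profile :=
  X2cnt_le_Xbar2_profile' hs hG hr hpl hg hg10

/-- **Theorem 22.12 at `t = 3` (§21.18.9.5)**: `10·J3low(π(G)) ≤ 10·J₃(G)` for every normalisation of a plane-line set
with plane traces `≤ g − 3` and `7 ≤ g ≤ 10`. -/
theorem J3_10_profile_le (hs : Simple M) (hG : G ⊆ gr M) (hr : M.eRk (G : Set α) = 4)
    (hpl : ∀ P ∈ planes M, (P ∩ G).card + 3 ≤ G.card) (hg : 7 ≤ G.card) (hg10 : G.card ≤ 10) :
    (PL.J3_10 D.profile : ℚ) ≤ 10 * J M G 3 := by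
  have hid := J_three_identity hs hG hr
  have hcost := cost3_profile_le_K (D := D) hs hG hpl hg hg10
  have hbonus := bonus3_profile_le_K (D := D) hs hG hpl hg hg10
  have hlpp := lpp_profile_le_K (D := D) hs hG hpl hg hg10
  have hX : (X2cnt M G : ℚ) ≤ (PL.Xbar2 D.profile : ℚ) := by
    exact_mod_cast X2cnt_le_Xbar2_profile (D := D) hs hG hr hpl hg hg10
  have hF : (PL.F3_10 (PL.g D.profile) : ℚ) = 10 * F3 G.card := by
    rw [g_profile_eq]
    unfold PL.F3_10 F3 S3 S2
    simp only [PL_ch_eq_choose]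
    push_cast
    ring
  unfold PL.J3_10
  push_cast
  rw [hid]
  linarith

end PLData

/-- **The (γ) `t = 3` piece for `7 ≤ g ≤ 10`**: `0 ≤ J₃(G)` for every non-generic rank-`4` set with plane traces
`≤ g − 3` and `7 ≤ g ≤ 10` (the `LISTK g (g − 3)` rows all have `10·J3low > 0`). -/
theorem J_three_nonneg_of_planeLine_le_ten (hs : Simple M) (hG : G ⊆ gr M) (hr : M.eRk (G : Set α) = 4)
    (hng : ¬ Generic M G) (hpl : ∀ P ∈ planes M, (P ∩ G).card + 3 ≤ G.card) (hg7 : 7 ≤ G.card)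
    (hg10 : G.card ≤ 10) : 0 ≤ J M G 3 := by
  obtain ⟨D, -⟩ := exists_PLData hs hG hr hng
  have hle := D.J3_10_profile_le hs hG hr hpl hg7 hg10
  have hmem := D.profile_mem_LISTK hs hG hpl (by omega) hg10
  have hpos : (0 : ℚ) < PL.J3_10 D.profile := by exact_mod_cast PL.J3_10_pos_of_mem hg7 hg10 hmem
  linarith

end PercRepro.SixFour
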